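import Mathlib
import HarnessLib
import HarnessLib.Audit
import Summits.QuantumAdvantage.Statement
import Literature.Computability.QuantumComplexity.StabilizerRank

/-!
Route: GenericAngle

CLOSED (retired) 2026-08-15T13:50:52Z by operator:999:1257524 — reason: not-a-thesis: assembly does not conclude the sub-problem Statement — note: D-0027 §2.1 audit (human 2026-08-15: routes that do not decide the summit are removed): the assembly concludes `ExactRankSuperpoly`, not the sub-problem statement; a NEW conforming route may be opened from the same idea (generated `closes : … → _root_.QuantumAdvantage`).. The file is kept as the record of this route; refuted decls are indexed as negative knowledge (`ledger negatives`).

# Route GenericAngle — Magic is as hard as a generic angle — superpolynomial stabilizer rank of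
|T>^n iff the Dicke basis of Sym^n needs superpolynomially many stabilizer states

ENGINE ROUTE for the S-side exact kill statement stmt-QuantumAdvantage-1794 (superpolynomial EXACT
stabilizer rank of |T⟩^{⊗t}; ModularRank.ExactRankSuperpoly = FermionicMagic.NegExactStabrankPoly,
re-wanted here as Target); realises idea card cusp-rank-tribonacci-census (its K3 "generic symmetric
span", K2 "CM defect", P1 tribonacci identity), magic-free. It suffices to show X =
GenericSpanSuperpoly: the least number χ_gen(n) of n-qubit stabilizer states whose linear span
contains every symmetric product state ψ^{⊗n} (equivalently the n+1 Dicke states, LovitzSteffan2022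
Prop 5.3/5.4; = the GENERIC stabilizer rank of LS22 §5, = the card's "cusp-rank of the Veronese
curve of diagonal period matrices") is not polynomially bounded (filed in the 'infinitely often,
arbitrarily far out' form ∀ c ∀ n₀ ∃ n ≥ n₀ that mirrors stmt-1794's ∀ c ∃ t; every proof will give
the eventual form). The transfer to the magic state is a PROVABLE sandwich (support GenericLeMagic /
MagicLeGeneric): χ(T^{⊗m}) ≤ χ_gen(m) ≤ (m+1)·χ(T^{⊗2m²}) — m+1 pairwise distinct angles ψ_j = |0⟩ +
√2^j|1⟩ are reachable from 2j copies of |T⟩ per output qubit by Clifford gates and Pauli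
postselections, each ψ_j^{⊗m} therefore has χ ≤ χ(T^{⊗2jm}) (Bravyi–Gosset gadgetisation, proved in
the tree), and m+1 distinct angles span Sym^m (Vandermonde; LS22 Prop 5.5). Hence X ⇔ Target (both
directions provable now: Assembly and support TargetImpliesGeneric), and the stronger crux
GenericSpanExponential (χ_gen(n) ≥ 2^{cn}, the card's K3 = BSS16's "χ_n ≥ 2^{Ω(n)}" for the generic
angle) gives χ(T^{⊗n}) ≥ 2^{Ω(√n)} (StretchedExpRank) and, with the card's CM-defect crux
MagicDefectSubexp, exponential exact rank (CodeFlattening.ExpStabilizerRank = stmt-2115). Closing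
1794/2115 kills the exact half of Dequantize's hypothesis; it does not decide the summit, and the
route says so.
Lean: `∀ c : ℕ, ∀ n₀ : ℕ, ∃ n ≥ n₀, ∀ (r : ℕ) (σ : Fin r →
Literature.Computability.Cryptography.QReg n → ℂ), (∀ i, σ i ∈
Literature.Computability.QuantumComplexity.stabilizerStates n) → (∀ ψ :
Literature.Computability.Cryptography.QReg 1 → ℂ,
Literature.Computability.QuantumComplexity.tensorPow ψ n ∈ Submodule.span ℂ (Set.range σ)) → n ^ c +
c < r`

## Assembly
Bookkeeping in ℕ (provable now): given c, apply X with exponent 2c+2 and threshold n₀ = 2(2^c + c) +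
2 to get m ≥ n₀ at which EVERY stabilizer cover of Sym^m has more than m^{2c+2} + 2c + 2 members;
the GenericLeMagic family at m then gives m^{2c+2} + 2c + 2 < r ≤ (m+1)·χ(T^{⊗2m²}); since
(m+1)((2m²)^c + c) ≤ 2(2^c + c)·m^{2c+1} ≤ m^{2c+2} for such m, dividing by m+1 gives (2m²)^c + c <
χ(T^{⊗2m²}); put t := 2m². The converse (Target ⇒ X) is support TargetImpliesGeneric. The conclusion
is stmt-1794's statement (decl ExactRankSuperpoly), an S-side kill statement shared with
ModularRank/FermionicMagic — not QuantumAdvantage or its negation (engine route, as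
CodeFlattening/MagicSpectrum).

Rationale: WHY THIS LINE. Every lower-bound technique in print attacks the arithmetic of ONE special vector,
|T⟩^{⊗n} (quadratic-phase / Gowers-U³ structure: PelegShpilkaVolk2022 Thm 1.1, Labib2022; subset-sum
representations: LovitzSteffan2022 Thm 3.x; probabilistic method: MehrabanTahmasbi2024) and stalls
at Ω(n) exact (PSV22 §1.5 "seem incapable of proving super-linear lower bounds"). The card's moduli
reading (stabilizer states = cusps, product states = diagonal period matrices, |T⟩^{⊗n} = the CM
point E_i^n) says the magic state is a SPECIAL point of a one-parameter family whose GENERIC member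
is at least as hard (χ(T^{⊗n}) ≤ χ_gen(n), LS22 §5) and is free of arithmetic accidents: for a
transcendental angle the rank is exactly χ_gen(n) and the question becomes pure combinatorics of F₂ⁿ
— how many affine-subspace quadratic-phase vectors does it take to span the n+1 Hamming-slice
indicators D^n_0,…,D^n_n (0/1 vectors) — a covering problem open even at "χ_gen(n) − n → ∞". What
this route adds to LS22 (who "only manage to modestly improve" the bounds on χ_gen and note only
χ_gen(n) ≥ χ(T^{⊗n})) is the CONVERSE transfer by exact Clifford+T synthesis of many distinct angles
(GilesSelinger2013 / RossSelinger2016 number theory of ℤ[ω,1/√2]; BravyiGosset2016 gadgetisation;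
LS22 Prop 5.5): χ_gen(m) ≤ (m+1)·χ(T^{⊗2m²}), so the magic problem and the generic problem are the
SAME up to n ↦ 2n², and every superpolynomial lower bound for Dicke covers is a superpolynomial
lower bound for magic. Imported areas: algebraic geometry of secant varieties (LS22 Fact 5.1, Prop
5.3–5.6: genericity, finiteness of exceptional angles), exact synthesis over ℤ[ω,1/2] (angle
supply), additive combinatorics of symmetric Boolean functions versus quadratic phases (the proposed
attack on the cruxes: Smolensky/Green-type correlation bounds of Hamming slices with quadratic forms
over F₂), and the card's arithmetic census (tribonacci and the exceptional moduli J_2, J_3) as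
calibration. No physical analogy is used; the card's theta/moduli dictionary is heuristic
superstructure and is not needed to type any item. Versus sibling engines for the same kill
statements: CodeFlattening (rank methods / code flattenings), MagicSpectrum (Strassen functionals;
its NontrivialSpectrum "some state has exponential asymptotic rank" is implied by
GenericSpanExponential), ModularRank (reduction mod p of the T vector; lists the "angle half" as not
decomposed), FermionicMagic (Gaussian targets): none isolates the magic-free quantity χ_gen or has a
transfer from generic to T.

RANKED CRUXES. #0 ExactRankSuperpoly (target) — superpolynomial exact stabilizer rank of |T⟩^{⊗t}: ∀
c ∃ t, t^c + c < χ(|T⟩^{⊗t}) — stmt-QuantumAdvantage-1794 verbatim (ModularRank.ExactRankSuperpoly,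
FermionicMagic.NegExactStabrankPoly), reached here by the Assembly. (why it might fail: polynomial
exact rank of T^{⊗t} is excluded by no theorem: Ω(t) ≤ χ ≤ 2^{0.396t} (PSV22 Thm 1.1, QPG21);
superpolynomial only conditionally (MT24 Thm 1.6).) [PelegShpilkaVolk2022, QassimPashayanGosset2021,
MehrabanTahmasbi2024, LovitzSteffan2022]
#2 GenericSpanExponential (crux) — the generic stabilizer rank is exponential: ∃ c > 0 ∃ n₀ ∀ n ≥
n₀, every family of n-qubit stabilizer states whose span contains all symmetric product states
ψ^{⊗n} has more than 2^{cn} members (card K3; = BravyiSmithSmolin2016 p.7 conjecture "χ_n ≥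
2^{Ω(n)}" transported to the generic angle, where it is WEAKER than for |H⟩; equivalently the n+1
Dicke states D^n_k jointly need 2^{cn} stabilizer states). Via ExponentialGlue it yields χ(T^{⊗n}) ≥
2^{Ω(√n)} (StretchedExpRank) and, with MagicDefectSubexp, 2^{Ω(n)} (ExpStabilizerRank). [difficulty:
open-problem] (why it might fail: χ_gen(n) = 2^{o(n)} is not excluded: only n+1 ≤ χ_gen(n) ≤
O(2^{n/2}) is known (LS22 Prop 5.2/5.3); Dicke states D^n_k might admit 2^{O(√n log n)}-term joint
covers by affine-code states, which would also make T^{⊗n} subexponential.) [LovitzSteffan2022,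
BravyiSmithSmolin2016, QassimPashayanGosset2021, arXiv:2110.07781 §1.4.2 and Prop 5.2-5.6 (pp.5,
13-14)]
#3 GenericSpanSuperpoly (crux) — thesis X — the generic stabilizer rank is not polynomially bounded:
∀ c ∀ n₀ ∃ n ≥ n₀ such that every family of stabilizer states whose span contains all ψ^{⊗n} has
more than n^c + c members (i.o. form mirroring stmt-1794; the eventual form ∀ c ∃ n₀ ∀ n ≥ n₀ is
what a proof will give and implies it). LOAD-BEARING for the Assembly and, by the sandwich
(GenericLeMagic, MagicLeGeneric, χ ≤ 2ⁿ), EQUIVALENT to the Target (supports Assembly /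
TargetImpliesGeneric, both provable now): the magic-free restatement of superpolynomial exact magic
rank (the joint stabilizer covering number of the Hamming-slice indicators D^n_0..D^n_n is
superpolynomial). [difficulty: open-problem] (why it might fail: equivalent (up to n ↦ 2n²) to
superpolynomial exact rank of T^{⊗n}, whose negation is a 'complexity heresy' (BBCCGH19 p.6) but
contradicts no theorem; best lower bound on χ_gen(n) is the dimension bound n+1 (LS22 Prop 5.3),
analytic methods give only Ω(n).) [LovitzSteffan2022, BravyiEtAl2019, PelegShpilkaVolk2022,
arXiv:2110.07781 Prop 5.3-5.5 (pp.13-14)]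
#4 GenericSpanSuperlinear (crux) — first rung — the generic stabilizer rank is superlinear: ∀ C ∃ n₀
∀ n ≥ n₀, every family of stabilizer states whose span contains all ψ^{⊗n} has more than C·n
members. The weakest asymptotic statement beyond the dimension bound; weaker than superlinear
χ(T^{⊗n}) (Williams' question, PSV22 §1.4) since χ(T^{⊗n}) ≤ χ_gen(n); for a transcendental angle
pure F₂ⁿ-combinatorics (no short joint cover of the Dicke basis by quadratic-phase affine-code
vectors). [difficulty: L] (why it might fail: χ_gen(n) = O(n) contradicts nothing known (χ_gen(n) =
n+1 for n ≤ 5, χ_gen(6) ≥ 8 by the card's census; χ(T^{⊗n}) ≥ n/100 only): rotated GHZ/code states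
might complete the ≤ 18 symmetric stabilizer states to an O(n) cover of Sym^n.) [LovitzSteffan2022,
PelegShpilkaVolk2022, BravyiSmithSmolin2016, card cusp-rank-tribonacci-census (census χ_gen(n), n ≤
6)]
#5 MagicDefectSubexp (crux) — the CM defect is subexponential (card K2): ∀ ε > 0 ∃ n₀ ∀ n ≥ n₀ there
is a family of at most 2^{εn}·χ(T^{⊗n}) stabilizer states whose span contains all ψ^{⊗n} — |T⟩ is at
most subexponentially cheaper than a generic angle. Only needed to upgrade GenericSpanExponential to
exponential magic rank (ExponentialGlue (ii) → ExpStabilizerRank = stmt-2115); a CONSTRUCTIVE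
transfer claim (improve GenericLeMagic's n ↦ 2n² to n ↦ n + o(n)), attackable by exact-synthesis /
catalysis constructions and refutable by T-specific cheapness. [deps: GenericSpanExponential]
[difficulty: XL] (why it might fail: T may be exponentially cheaper than generic: χ(T^{⊗n}) ≤
2^{0.396n} (QPG21) while χ_gen(n) may be 2^{(1/2−o(1))n}; every non-stabilizer angle costs ≥ 1 T per
copy and only 2^{O(τ)} angles have T-count ≤ τ, so pure-power supplies lose n ↦ n log n.)
[QassimPashayanGosset2021, LovitzSteffan2022, BravyiSmithSmolin2016, RossSelinger2016,
arXiv:2605.28586 (χ(H^{⊗4}) = 4 > 3 ≥ χ(F^{⊗4}): the two CM orbits already differ)]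
#9 GenericLeMagic (support) — SYNTHESIS TRANSFER (provable now): for every m there is a family of at
most (m+1)·χ(T^{⊗2m²}) stabilizer states on m qubits whose span contains every ψ^{⊗m}. Proof: angles
ψ_j = |0⟩ + √2^j |1⟩ (j = 0..m, pairwise non-proportional); (1+X⊗X)/2 applied to |T⟩⊗|T⟩ followed by
CNOT gives a nonzero multiple of |+⟩ ⊗ (|0⟩+√2|1⟩), and CNOT + ⟨0| on the target realises the
entrywise product (a,b),(c,d) ↦ (ac,bd), so ψ_j^{⊗m} = L_j(T^{⊗2jm}) ⊗-padded, L_j a composition of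
Cliffords, Pauli projections (1+P)/2 and ⟨0|-postselections, all of which map stabilizer states to
scaled stabilizer states (tree: StabilizerFormalism.exists_smul_stabilizer_of_pauliProj,
exists_smul_stabilizer_projZ, gadgetize; alternative supply (T·H)^j|0⟩ via
BravyiGosset2016_stabilizerRank_output_le_holds and the irrational rotation angle cos θ =
−(2+√2)/4); hence χ(ψ_j^{⊗m}) ≤ χ(T^{⊗2jm}) ≤ χ(T^{⊗2m²}) (CopyMonotone); m+1 distinct angles: their
m-th powers span Sym^m ∋ ψ^{⊗m} (Vandermonde on binary forms; LS22 Prop 5.5); concatenate the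
decompositions (tree: exists_stabilizerDecomposition, stabilizerRank_le_card). m = 0: r = 1.
[difficulty: provable-now] [LovitzSteffan2022, BravyiGosset2016, BravyiEtAl2019, GilesSelinger2013]
#9 MagicLeGeneric (support) — trivial direction (provable now): any stabilizer family whose span
contains all ψ^{⊗n} has at least χ(T^{⊗n}) members (T^{⊗n} = tensorPow magicT n lies in the span:
Submodule.mem_span_range_iff_exists_fun, Nat.sInf_le). Records that refuting X refutes 1794, 2115
and 0247 at once. [difficulty: provable-now] [LovitzSteffan2022, Mathlib
Submodule.mem_span_range_iff_exists_fun]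
#9 CopyMonotone (support) — copy monotonicity (provable now): if ψ(|0⟩) ≠ 0 then χ(ψ^{⊗k}) ≤
χ(ψ^{⊗(k+l)}) — project the last l wires onto ⟨0|: projZ l (ψ^{⊗k} ⊗ ψ^{⊗l}) = ψ(0)^l · ψ^{⊗k}
(tree: tensorPow_add, projZ_tensorVec) and ⟨0|-postselection maps stabilizer states to scaled
stabilizer states (exists_smul_stabilizer_projZ). Used with ψ = magicT (magicT 0 = 1/√2) in
GenericLeMagic and ExponentialGlue. [difficulty: provable-now] [BravyiSmithSmolin2016,
BravyiEtAl2019, AaronsonGottesman2004]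
#9 StretchedExpRank (support) — MILESTONE statement (new S-side decl between 1794 and 2115):
stretched-exponential exact magic rank, ∃ c > 0 ∃ n₀ ∀ n ≥ n₀, 2^{c√n} < χ(T^{⊗n}). Not to be
attacked directly; reached from GenericSpanExponential by ExponentialGlue (i) (a 2^{Ω(τ)}-angle
supply at T-count τ, Kliuchnikov–Maslov–Mosca / Ross–Selinger counting, would sharpen it to 2^{Ω(n /
log n)} — see Not decomposed yet). [difficulty: open-problem] [PelegShpilkaVolk2022,
LovitzSteffan2022]
#9 ExpStabilizerRank (support) — exponential exact magic rank, ∃ c > 0 ∃ n₀ ∀ n ≥ n₀, 2^{cn} <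
χ(T^{⊗n}) — stmt-QuantumAdvantage-2115 verbatim (CodeFlattening.ExpStabilizerRank; shared by
signature); here the conclusion of ExponentialGlue (ii), not attacked directly. [difficulty:
open-problem] [PelegShpilkaVolk2022, LovitzSteffan2022, arXiv:2605.28586 p.4]
#9 ExponentialGlue (support) — glue for both exponential upgrades (provable now). (i)
GenericSpanExponential → GenericLeMagic → CopyMonotone → StretchedExpRank: for n large put m =
⌊√(n/2)⌋ (so 2m² ≤ n and m ≥ the crux's n₀); χ(T^{⊗n}) ≥ χ(T^{⊗2m²}) ≥ r/(m+1) > 2^{cm}/(m+1) ≥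
2^{(c/4)√n} (Nat.sqrt/Real.sqrt bookkeeping, magicT 0 = 1/√2 ≠ 0). (ii) GenericSpanExponential →
MagicDefectSubexp → ExpStabilizerRank (the card's original assembly K3 ∧ K2 ⇒ exponential): take ε =
c/2, then 2^{cn} < r ≤ 2^{εn}·χ(T^{⊗n}) gives χ(T^{⊗n}) > 2^{(c/2)n}. [difficulty: provable-now]
[LovitzSteffan2022, BravyiSmithSmolin2016]
#9 TargetImpliesGeneric (support) — converse of the Assembly (provable now), recording X ⇔
stmt-1794: MagicLeGeneric → ExactRankSuperpoly → GenericSpanSuperpoly. Given c and n₀ apply the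
target with exponent c'' = max(c, 2^{n₀}): t^{c''} + c'' < χ(T^{⊗t}) ≤ 2^t (tree:
stabilizerRank_le_two_pow) forces t > n₀, and every stabilizer cover of Sym^t has r ≥ χ(T^{⊗t}) >
t^{c''} + c'' ≥ t^c + c. [difficulty: provable-now] [LovitzSteffan2022, BravyiSmithSmolin2016]
#9 TribonacciRankThree (support) — CALIBRATION (card P1, provable now): for every root u of u³ + u²
+ u = 1 (tribonacci: u = 1/T, T³ = T² + T + 1), χ((|0⟩ + u|1⟩)^{⊗3}) ≤ 3, by the identity
(|0⟩+u|1⟩)^{⊗3} = u·(|001⟩+|010⟩+|100⟩−|111⟩) + (1−u²)·(|000⟩+|111⟩) + u²·(|000⟩+|011⟩+|101⟩+|110⟩)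
(weights 0,1,2 match identically, weight 3 reads −u + 1 − u² = u³); the three vectors are scaled
stabilizer states: CZ₁₂·X₃·(even-weight state), √2·GHZ = √2·CNOT₀₂CNOT₀₁H₀|000⟩, 2·H^{⊗3}GHZ. With
χ(T^{⊗3}) = 3 (BSS16 table, 'believed tight'; lower bound = the card's exact census E_{3,2}, a
finite certificate not filed here) this is a non-stabilizer, non-magic angle of magic rank at n = 3:
BravyiSmithSmolin2016 Conjecture 1 fails at n = 3. [difficulty: provable-now]
[BravyiSmithSmolin2016, arXiv:1506.01396 p.6 Conjecture 1, card cusp-rank-tribonacci-census]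

TWO-LAYER PLAN. Foreseen glued splits (none filed now): GenericSpanSuperlinear ⇐ ExcessUnbounded (∀
k ∃ n₀ ∀ n ≥ n₀, χ_gen(n) > n + k; k = 1 is the card's "every symmetric stabilizer state has Dicke
coordinates c₅ = c₁ for n ≥ 6", i.e. χ_gen(n) ≥ n+2, provable now from the classification of
permutation-symmetric stabilizer states) → SlackToSlope (a cover of size n + k forces all members
into Sym^n ⊕ E with dim E < k; rigidity of almost-symmetric stabilizer states) →
GenericSpanSuperlinear. GenericSpanSuperpoly ⇐ SliceLowerBound (some single Dicke slice D^n_{⌊n/2⌋}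
has superpolynomial stabilizer rank; χ_gen(n)/(n+1) ≤ max_k χ(D^n_k) ≤ χ_gen(n)) → glue.
MagicDefectSubexp: no split foreseen before GenericSpanExponential moves (pure-power angle supplies
cost ≥ c·m T-states per angle, so a subexponential-defect cover of Sym^n must use cheaper symmetric
states than powers — local-Clifford images and Pauli postselections of T^{⊗(n+o(n))} are the only
candidates in view).

KILL CRITERIA. ¬GenericSpanSuperpoly proved (a polynomial-size stabilizer cover of Sym^n,
necessarily constructive) ⇒ by MagicLeGeneric χ(T^{⊗n}) is polynomial: close
`refuted:GenericSpanSuperpoly`; this also refutes 1794, 2115 and Dequantize's kill item 0247 (χ_δ ≤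
χ) and revives Dequantize #2 — a landmark either way. ¬GenericSpanExponential with X open ⇒ drop the
ExponentialGlue upgrades, keep X (pivot: target stays 1794). ¬MagicDefectSubexp (T exponentially
cheaper than generic) ⇒ drop the 2115 upgrade only; the finding itself ("magic is exponentially
non-generic") goes to the card's exceptional-moduli programme. ¬GenericSpanSuperlinear ⇒ close
refuted (linear generic rank kills every rung). 1794 proved elsewhere ⇒ X follows (MagicLeGeneric):
route done/moot as an engine, supports remain as calibration.

NOT DECOMPOSED YET. (i) The 2^{Ω(n/log n)} sharpening of StretchedExpRank: needs an angle supply of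
2^{ατ} pairwise distinct single-qubit states of T-count ≤ τ (counting unit vectors of ℤ[ω,1/2] by
denominator exponent, Kliuchnikov–Maslov–Mosca 2013 arXiv:1206.5236, RossSelinger2016) — a
Literature fact to request once GenericSpanExponential moves. (ii) The card's exceptional-moduli
structure (K1: for n ≥ n₀ the only sub-generic non-stabilizer angles are the two CM classes;
integrality of J_n; the symmetric-hyperplane mechanism and its switch-off at n = 5) — census-level,
needs definitions kleinJ / exceptionalModuli; provers may attach the finite certificates (χ_gen(n) =
n+1 for n ≤ 5 via the six symmetric product stabilizer states; χ_gen(6) ≥ 8; E_{3,2} = ∅ i.e.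
χ(T^{⊗3}) = 3) with `--supports GenericSpanSuperlinear` / `--supports TribonacciRankThree`. (iii)
Real stabilizer states (LS22 Prop 5.4: factor 2) and the single-slice reduction. (iv) Approximate
rank: the sandwich does not see χ_δ (postselection is not δ-robust without norm control) — stated
limitation; 0247 proper stays with CodeFlattening/MagicSpectrum. Two layers only; no split before a
crux closes.

CHEAPEST FALSIFIER. For the ENGINE (the sandwich): a refuter checks GenericLeMagic at m = 2, 3 by
hand (χ_gen(2) = 3 ≤ 3·χ(T^{⊗8}); the (1+XX)/2-then-CNOT computation giving |+⟩⊗(1,√2) from T⊗T —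
done by this planner on paper, see NOTES) and that LS22 Prop 5.5 + BG16 gadgetisation are correctly
invoked; if the angle supply were NOT realisable by stabilizer operations the transfer dies. For the
LINE: compute χ_gen(n) exactly for n = 6, 7 (kit: symmetric-subspace containment over the 3.2·10⁸ /
8.2·10¹⁰ stabilizer states, cut down by LS22 Prop 5.4 (real states suffice up to a factor 2) and by
S_n × transversal-Clifford symmetry classes); χ_gen(n) = n + 2 persisting would make
GenericSpanSuperlinear look false and the whole generic line (and, by the sandwich, superpolynomial
magic rank itself) suspicious. Lookup already done: LS22 §1.4.2/§5 and Labib–Russo 2026 contain no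
generic→magic transfer and no χ_gen values beyond the bounds quoted.

NUMBERS. χ_gen(n) (LS22's χ_n, spanning form): = n+1 for n ≤ 5 (six symmetric product stabilizer
states |0^n⟩, |1^n⟩, (|0⟩+i^a|1⟩)^{⊗n}), ≥ 8 at n = 6 (card census), ≤ O(2^{n/2}) (LS22 Prop 5.2 via
QPG21 equatorial states), ≥ n+1 (dimension). Magic (edge orbit = tree magicT): χ(T^{⊗n}) ≤ 2, 3, 4,
6, 7 for n = 2..6 (BSS16 table, "believed tight"), χ(T^{⊗4}) = 4 exactly and χ(F^{⊗4}) ≤ 3 for the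
face orbit (arXiv:2605.28586), asymptotic exponent ≤ log₂3/4 ≈ 0.396 (QPG21), lower bounds n/100
(PSV22 Thm 1.1) and (n+1)/(4 log₂(n+1)) (LS22), approximate Ω̃(n²) (MT24). Sandwich: χ(T^{⊗m}) ≤
χ_gen(m) ≤ (m+1)·χ(T^{⊗2m²}). Sub-generic angles at level n: at most n·C(|Stab_n|, χ_gen(n)−1) (LS22
Prop 5.6); at n = 3 exactly the CM classes j ∈ {0, 1728} plus five classes incl. tribonacci (card
census J_3). Items at open: 14 (1 target, 4 cruxes, 8 supports, 1 assembly).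

DEFINITION REQUESTS. None needed to type the items (all over
Literature.Computability.QuantumComplexity.StabilizerRank: stabilizerStates, stabilizerRank,
tensorPow, magicT; Mathlib Submodule.span). If a Literature definition `genericStabilizerRank n` is
added later it should be the SPANNING form used here (least r such that r stabilizer states span ⊇
{ψ^{⊗n}}); LS22's max-form equals it only via Prop 5.3 (irreducibility of the Veronese curve). Cite
fact wanted later (not now): the ℤ[ω,1/2] angle-supply count (Kliuchnikov–Maslov–Mosca 2013;
RossSelinger2016) for the n/log n sharpening.

Novelty: Searches (2026-08-15): `lit search "stabilizer rank Dicke states W state lower bound"` (local 0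
relevant; OpenAlex/S2 HTTP 429, crossref 15: QPG21, PSV22, MT24, Kocia 2021 — nothing on
generic/Dicke covers); `lit search --source arxiv "generic stabilizer rank"` (10: LS22, Labib2022,
QPG21, HuangLove 2018), `"stabilizer rank symmetric states"` (QPG21 only relevant), `"stabilizer
rank tensor power single-qubit state lower bound"` (2: PSV22, arXiv:2605.28586), `"exact synthesis
single qubit Clifford T states count T-count"` (0); `lit galaxy search "generic stabilizer rank"
--star all` (1: Lovitz NSF project description), `"stabilizer rank of Dicke" --star all` (0),
`"stabilizer rank" --star pdf` (11: OWR 49/2021, Labib thesis, BBCCGH19, Pashayan et al. 2022,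
Dias–König 2024, …, none on χ_gen); `lit frontier QuantumAdvantage --since 2020` (30 rows, none on
stabilizer rank), `lit bridges QuantumAdvantage --cross any`; READ: arXiv:2110.07781 pp.3-5, 13-14
(Fact 5.1, Prop 5.2-5.6, §1.4.1-1.4.2), arXiv:1506.01396 pp.5-7, 16 (table χ_n ≤ 2,3,4,6,7;
Conjecture 1; "χ_n ≥ 2^{Ω(n)}" conjecture), arXiv:2605.28586 pp.2, 4, 12 (orbit dependence at n = 4;
open problems), the tree's StabilizerSimulation*.lean (what is proved), the sibling route files
ModularRank/CodeFlattening/MagicSpectrum/FermionicMagic/AmplitudeProofs, `ledger negatives --problem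
QuantumAdvantage` (1, unrelated).
Nearest prior art found: LovitzSteffan2022 = arXiv:2110.07781 §5 (defines χ_gen, proves genericity,
χ_gen ≥ χ(T^  [refs: 2605.28586, 2110.07781, 1506.01396, Labib2022, LovitzSteffan2022, BravyiSmithSmolin2016]

Barriers (technique_class: stabilizer-rank, exact-synthesis, generic-rank): - technique_class: stabilizer-rank, exact-synthesis, generic-rank
- Literature.Barriers.QuantumAdvantage.NaturalProofs: not engaged — the items are lower bounds on a
rank function of explicit 2ⁿ-vectors (Dicke states, |T⟩^{⊗n}), not circuit lower bounds via a large
constructive property of Boolean functions; no pseudorandomness of low-stabilizer-rank states is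
known that would make an RR-type obstruction bite (the only conditional link runs the other way:
MT24 Thm 1.6 derives rank lower bounds FROM perm ∉ P/poly-type hypotheses). Recorded honestly as the
sibling 0247/1794 routes do.
- Literature.Barriers.QuantumAdvantage.Relativization: n/a — no oracle statement; stabilizer covers
of Sym^n are non-black-box linear algebra over explicit gate lists (same verdict as Dequantize's
barrier field for the simulation side).
- Literature.Barriers.QuantumAdvantage.Algebrization: n/a — no inclusion C^A ⊆ D^Ã is proved or
refuted; no arithmetisation.
- Literature.Barriers.QuantumAdvantage.SeparationPrerequisites: n/a — the route proves no class
separation; closing 1794 kills a simulation hypothesis and does not prove S (said in the Thesis).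
- Literature.Barriers.QuantumAdvantage.PPolyOracles, .RandomOracleMethod,
.SupremacyTheoremsNonRelativizing, .TotalFunctionSpeedupLimit, .NoiseThresholdUpperBounds,
.UncorrectedNoise, .BoundedEntanglement, .TensorNetworkContraction, .LinearXEBSpoofing,
.LatticeRigidity: n/a — no sampling, oracle, device, noise, depth or lattice-cryptography claim.
- No

History (route lifecycle, newest last):
- 2026-08-15T13:50:52Z · CLOSED retired — not-a-thesis: assembly does not conclude the sub-problem Statement (operator:999:1257524)

sub-problem: QuantumAdvantage · status: closed(retired) · opened planner-plancard-QuantumAdvantage-QuantumAdva-37aec22f-0 2026-08-15T12:39:35Z · rev 0 · ledger route-QuantumAdvantage-GenericAngle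
GENERATED by the gate from the ledger (D-0016/17). Provers cite these decls: `theorem foo : Summit.QuantumAdvantage.QuantumAdvantage.Theses.GenericAngle.<Decl> := …` in Summits/QuantumAdvantage/QuantumAdvantage/Theorems/<Name>.lean.
-/

namespace Summit.QuantumAdvantage.QuantumAdvantage.Theses.GenericAngle

open scoped BigOperators Topology Manifold Classical MeasureTheory ProbabilityTheory Matrix InnerProductSpace ComplexConjugate ContinuousMap
open Filter Set Function TopologicalSpace MeasureTheory

attribute [summit_statement] _root_.QuantumAdvantage

open Literature.QuantumAdvantage

/-- item stmt-QuantumAdvantage-1794 · target · rank 0 · open · by planner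
why it might fail: polynomial exact rank of T^{⊗t} is excluded by no theorem: Ω(t) ≤ χ ≤ 2^{0.396t} (PSV22 Thm 1.1, QPG21); superpolynomial only conditionally (MT24 Thm 1.6).
sources: PelegShpilkaVolk2022, QassimPashayanGosset2021, MehrabanTahmasbi2024, LovitzSteffan2022
[crux] S-SIDE CLASSICAL CORE: superpolynomial EXACT stabilizer rank of |T⟩^{⊗t} over ℂ, typed over
the landed StabilizerRank.lean: ∀ c ∃ t, t^c + c < stabilizerRank (tensorPow magicT t). The δ = 0
shadow of Dequantize's kill item 0247 (which asks it for some δ ∈ (0,1) and is STRONGER: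
approxStabilizerRank_le_stabilizerRank); previously unfiled on the hub although it is the best-known
open problem of the area (superlinear is open). Inside this route it is the archimedean face of
ModularRankSuperpoly (support ModularToExact via the transfer lemma). Note for provers:
stabilizerRank is an sInf, so any lower bound needs nonemptiness of the decomposition set
(computational basis states are stabilizer states: X = H·S·S·H). -/
@[route_item "route-QuantumAdvantage-GenericAngle"]
def ExactRankSuperpoly : Prop :=
  ∀ c : ℕ, ∃ t : ℕ, t ^ c + c < Literature.Computability.QuantumComplexity.stabilizerRank (Literature.Computability.QuantumComplexity.tensorPow Literature.Computability.QuantumComplexity.magicT t)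

/-- item stmt-QuantumAdvantage-8334 · crux · rank 2 · closed · moot by None · by planner
why it might fail: χ_gen(n) = 2^{o(n)} is not excluded: only n+1 ≤ χ_gen(n) ≤ O(2^{n/2}) is known (LS22 Prop 5.2/5.3); Dicke states D^n_k might admit 2^{O(√n log n)}-term joint covers by affine-code states, which would also make T^{⊗n} subexponential.
sources: LovitzSteffan2022, BravyiSmithSmolin2016, QassimPashayanGosset2021, arXiv:2110.07781 §1.4.2 and Prop 5.2-5.6 (pp.5, 13-14)
[crux] the generic stabilizer rank is exponential: ∃ c > 0 ∃ n₀ ∀ n ≥ n₀, every family of n-qubit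
stabilizer states whose span contains all symmetric product states ψ^{⊗n} has more than 2^{cn}
members (card K3; = BravyiSmithSmolin2016 p.7 conjecture "χ_n ≥ 2^{Ω(n)}" transported to the generic
angle, where it is WEAKER than for |H⟩; equivalently the n+1 Dicke states D^n_k jointly need 2^{cn}
stabilizer states). Via ExponentialGlue it yields χ(T^{⊗n}) ≥ 2^{Ω(√n)} (StretchedExpRank) and, with
MagicDefectSubexp, 2^{Ω(n)} (ExpStabilizerRank). [difficulty: open-problem] -/
@[route_item "route-QuantumAdvantage-GenericAngle"]
def GenericSpanExponential : Prop :=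
  ∃ c : ℝ, 0 < c ∧ ∃ n₀ : ℕ, ∀ n ≥ n₀, ∀ (r : ℕ) (σ : Fin r → Literature.Computability.Cryptography.QReg n → ℂ), (∀ i, σ i ∈ Literature.Computability.QuantumComplexity.stabilizerStates n) → (∀ ψ : Literature.Computability.Cryptography.QReg 1 → ℂ, Literature.Computability.QuantumComplexity.tensorPow ψ n ∈ Submodule.span ℂ (Set.range σ)) → (2 : ℝ) ^ (c * n) < r

/-- item stmt-QuantumAdvantage-8335 · crux · rank 3 · closed · moot by None · by planner
why it might fail: equivalent (up to n ↦ 2n²) to superpolynomial exact rank of T^{⊗n}, whose negation is a 'complexity heresy' (BBCCGH19 p.6) but contradicts no theorem; best lower bound on χ_gen(n) is the dimension bound n+1 (LS22 Prop 5.3), analytic methods give only Ω(n).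
sources: LovitzSteffan2022, BravyiEtAl2019, PelegShpilkaVolk2022, arXiv:2110.07781 Prop 5.3-5.5 (pp.13-14)
[crux] thesis X — the generic stabilizer rank is not polynomially bounded: ∀ c ∀ n₀ ∃ n ≥ n₀ such
that every family of stabilizer states whose span contains all ψ^{⊗n} has more than n^c + c members
(i.o. form mirroring stmt-1794; the eventual form ∀ c ∃ n₀ ∀ n ≥ n₀ is what a proof will give and
implies it). LOAD-BEARING for the Assembly and, by the sandwich (GenericLeMagic, MagicLeGeneric, χ ≤
2ⁿ), EQUIVALENT to the Target (supports Assembly / TargetImpliesGeneric, both provable now): the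
magic-free restatement of superpolynomial exact magic rank (the joint stabilizer covering number of
the Hamming-slice indicators D^n_0..D^n_n is superpolynomial). [difficulty: open-problem] -/
@[route_item "route-QuantumAdvantage-GenericAngle"]
def GenericSpanSuperpoly : Prop :=
  ∀ c : ℕ, ∀ n₀ : ℕ, ∃ n ≥ n₀, ∀ (r : ℕ) (σ : Fin r → Literature.Computability.Cryptography.QReg n → ℂ), (∀ i, σ i ∈ Literature.Computability.QuantumComplexity.stabilizerStates n) → (∀ ψ : Literature.Computability.Cryptography.QReg 1 → ℂ, Literature.Computability.QuantumComplexity.tensorPow ψ n ∈ Submodule.span ℂ (Set.range σ)) → n ^ c + c < r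

/-- item stmt-QuantumAdvantage-8336 · crux · rank 4 · closed · moot by None · by planner
why it might fail: χ_gen(n) = O(n) contradicts nothing known (χ_gen(n) = n+1 for n ≤ 5, χ_gen(6) ≥ 8 by the card's census; χ(T^{⊗n}) ≥ n/100 only): rotated GHZ/code states might complete the ≤ 18 symmetric stabilizer states to an O(n) cover of Sym^n.
sources: LovitzSteffan2022, PelegShpilkaVolk2022, BravyiSmithSmolin2016, card cusp-rank-tribonacci-census (census χ_gen(n), n ≤ 6)
[crux] first rung — the generic stabilizer rank is superlinear: ∀ C ∃ n₀ ∀ n ≥ n₀, every family of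
stabilizer states whose span contains all ψ^{⊗n} has more than C·n members. The weakest asymptotic
statement beyond the dimension bound; weaker than superlinear χ(T^{⊗n}) (Williams' question, PSV22
§1.4) since χ(T^{⊗n}) ≤ χ_gen(n); for a transcendental angle pure F₂ⁿ-combinatorics (no short joint
cover of the Dicke basis by quadratic-phase affine-code vectors). [difficulty: L] -/
@[route_item "route-QuantumAdvantage-GenericAngle"]
def GenericSpanSuperlinear : Prop :=
  ∀ C : ℕ, ∃ n₀ : ℕ, ∀ n ≥ n₀, ∀ (r : ℕ) (σ : Fin r → Literature.Computability.Cryptography.QReg n → ℂ), (∀ i, σ i ∈ Literature.Computability.QuantumComplexity.stabilizerStates n) → (∀ ψ : Literature.Computability.Cryptography.QReg 1 → ℂ, Literature.Computability.QuantumComplexity.tensorPow ψ n ∈ Submodule.span ℂ (Set.range σ)) → C * n < r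

/-- item stmt-QuantumAdvantage-8337 · crux · rank 5 · closed · moot by None · by planner
why it might fail: T may be exponentially cheaper than generic: χ(T^{⊗n}) ≤ 2^{0.396n} (QPG21) while χ_gen(n) may be 2^{(1/2−o(1))n}; every non-stabilizer angle costs ≥ 1 T per copy and only 2^{O(τ)} angles have T-count ≤ τ, so pure-power supplies lose n ↦ n log n.
sources: QassimPashayanGosset2021, LovitzSteffan2022, BravyiSmithSmolin2016, RossSelinger2016, arXiv:2605.28586 (χ(H^{⊗4}) = 4 > 3 ≥ χ(F^{⊗4}): the two CM orbits already differ)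
[crux] the CM defect is subexponential (card K2): ∀ ε > 0 ∃ n₀ ∀ n ≥ n₀ there is a family of at most
2^{εn}·χ(T^{⊗n}) stabilizer states whose span contains all ψ^{⊗n} — |T⟩ is at most subexponentially
cheaper than a generic angle. Only needed to upgrade GenericSpanExponential to exponential magic
rank (ExponentialGlue (ii) → ExpStabilizerRank = stmt-2115); a CONSTRUCTIVE transfer claim (improve
GenericLeMagic's n ↦ 2n² to n ↦ n + o(n)), attackable by exact-synthesis / catalysis constructions
and refutable by T-specific cheapness. [deps: GenericSpanExponential] [difficulty: XL] -/
@[route_item "route-QuantumAdvantage-GenericAngle"]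
def MagicDefectSubexp : Prop :=
  ∀ ε : ℝ, 0 < ε → ∃ n₀ : ℕ, ∀ n ≥ n₀, ∃ (r : ℕ) (σ : Fin r → Literature.Computability.Cryptography.QReg n → ℂ), (∀ i, σ i ∈ Literature.Computability.QuantumComplexity.stabilizerStates n) ∧ (∀ ψ : Literature.Computability.Cryptography.QReg 1 → ℂ, Literature.Computability.QuantumComplexity.tensorPow ψ n ∈ Submodule.span ℂ (Set.range σ)) ∧ (r : ℝ) ≤ (2 : ℝ) ^ (ε * n) * Literature.Computability.QuantumComplexity.stabilizerRank (Literature.Computability.QuantumComplexity.tensorPow Literature.Computability.QuantumComplexity.magicT n)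

/-- item stmt-QuantumAdvantage-2115 · support · rank 9 · closed · moot by None · by planner
sources: PelegShpilkaVolk2022, LovitzSteffan2022, arXiv:2605.28586 p.4
[support] Terminal statement of the EXACT horn: ∃ c > 0 ∃ n₀ ∀ n ≥ n₀, 2^{cn} < χ(|T⟩^{⊗n}) —
exponential exact stabilizer rank of magic-state powers. Far beyond print (Ω(n):
PelegShpilkaVolk2022 Thm 1.1, Labib2022 Thm 1.1, arXiv:2110.07781; 'seem incapable of proving
super-linear lower bounds', PSV22 p.6 §1.5; exponential exact rank is known only for product states
with transcendental amplitudes, arXiv:2110.07781 §1/§3 via Moulton; upper bound χ(T^{⊗n}) ≤ 2^{0.396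
n}, arXiv:2605.28586 p.4). NOT to be attacked directly in this route — it is reached via ExactGlue
from ExactFlatteningWitness; filed as a plain decl so that other engines aimed at the same statement
(hub cards counterfeit-magic-dichotomy, magic-asymptotic-spectrum,
specialize-the-angle-reduce-the-prime) share it by signature. -/
@[route_item "route-QuantumAdvantage-GenericAngle"]
def ExpStabilizerRank : Prop :=
  ∃ c : ℝ, 0 < c ∧ ∃ n₀ : ℕ, ∀ n ≥ n₀, (2 : ℝ) ^ (c * n) < (Literature.Computability.QuantumComplexity.stabilizerRank (Literature.Computability.QuantumComplexity.tensorPow Literature.Computability.QuantumComplexity.magicT n) : ℝ)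

/-- item stmt-QuantumAdvantage-8338 · support · rank 9 · closed · moot by None · by planner
sources: LovitzSteffan2022, BravyiGosset2016, BravyiEtAl2019, GilesSelinger2013
[support] SYNTHESIS TRANSFER (provable now): for every m there is a family of at most
(m+1)·χ(T^{⊗2m²}) stabilizer states on m qubits whose span contains every ψ^{⊗m}. Proof: angles ψ_j
= |0⟩ + √2^j |1⟩ (j = 0..m, pairwise non-proportional); (1+X⊗X)/2 applied to |T⟩⊗|T⟩ followed by
CNOT gives a nonzero multiple of |+⟩ ⊗ (|0⟩+√2|1⟩), and CNOT + ⟨0| on the target realises the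
entrywise product (a,b),(c,d) ↦ (ac,bd), so ψ_j^{⊗m} = L_j(T^{⊗2jm}) ⊗-padded, L_j a composition of
Cliffords, Pauli projections (1+P)/2 and ⟨0|-postselections, all of which map stabilizer states to
scaled stabilizer states (tree: StabilizerFormalism.exists_smul_stabilizer_of_pauliProj,
exists_smul_stabilizer_projZ, gadgetize; alternative supply (T·H)^j|0⟩ via
BravyiGosset2016_stabilizerRank_output_le_holds and the irrational rotation angle cos θ =
−(2+√2)/4); hence χ(ψ_j^{⊗m}) ≤ χ(T^{⊗2jm}) ≤ χ(T^{⊗2m²}) (CopyMonotone); m+1 distinct angles: their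
m-th powers span Sym^m ∋ ψ^{⊗m} (Vandermonde on binary forms; LS22 Prop 5.5); concatenate the
decompositions (tree: exists_stabilizerDecomposition, stabilizerRank_le_card). m = 0: r = 1.
[difficulty: provable-now] -/
@[route_item "route-QuantumAdvantage-GenericAngle"]
def GenericLeMagic : Prop :=
  ∀ m : ℕ, ∃ (r : ℕ) (σ : Fin r → Literature.Computability.Cryptography.QReg m → ℂ), (∀ i, σ i ∈ Literature.Computability.QuantumComplexity.stabilizerStates m) ∧ (∀ ψ : Literature.Computability.Cryptography.QReg 1 → ℂ, Literature.Computability.QuantumComplexity.tensorPow ψ m ∈ Submodule.span ℂ (Set.range σ)) ∧ r ≤ (m + 1) * Literature.Computability.QuantumComplexity.stabilizerRank (Literature.Computability.QuantumComplexity.tensorPow Literature.Computability.QuantumComplexity.magicT (2 * m * m))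

/-- item stmt-QuantumAdvantage-8339 · support · rank 9 · closed · moot by None · by planner
sources: LovitzSteffan2022, Mathlib Submodule.mem_span_range_iff_exists_fun
[support] trivial direction (provable now): any stabilizer family whose span contains all ψ^{⊗n} has
at least χ(T^{⊗n}) members (T^{⊗n} = tensorPow magicT n lies in the span:
Submodule.mem_span_range_iff_exists_fun, Nat.sInf_le). Records that refuting X refutes 1794, 2115
and 0247 at once. [difficulty: provable-now] -/
@[route_item "route-QuantumAdvantage-GenericAngle"]
def MagicLeGeneric : Prop :=
  ∀ (n r : ℕ) (σ : Fin r → Literature.Computability.Cryptography.QReg n → ℂ), (∀ i, σ i ∈ Literature.Computability.QuantumComplexity.stabilizerStates n) → (∀ ψ : Literature.Computability.Cryptography.QReg 1 → ℂ, Literature.Computability.QuantumComplexity.tensorPow ψ n ∈ Submodule.span ℂ (Set.range σ)) → Literature.Computability.QuantumComplexity.stabilizerRank (Literature.Computability.QuantumComplexity.tensorPow Literature.Computability.QuantumComplexity.magicT n) ≤ r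

/-- item stmt-QuantumAdvantage-8340 · support · rank 9 · closed · moot by None · by planner
sources: BravyiSmithSmolin2016, BravyiEtAl2019, AaronsonGottesman2004
[support] copy monotonicity (provable now): if ψ(|0⟩) ≠ 0 then χ(ψ^{⊗k}) ≤ χ(ψ^{⊗(k+l)}) — project
the last l wires onto ⟨0|: projZ l (ψ^{⊗k} ⊗ ψ^{⊗l}) = ψ(0)^l · ψ^{⊗k} (tree: tensorPow_add,
projZ_tensorVec) and ⟨0|-postselection maps stabilizer states to scaled stabilizer states
(exists_smul_stabilizer_projZ). Used with ψ = magicT (magicT 0 = 1/√2) in GenericLeMagic and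
ExponentialGlue. [difficulty: provable-now] -/
@[route_item "route-QuantumAdvantage-GenericAngle"]
def CopyMonotone : Prop :=
  ∀ (ψ : Literature.Computability.Cryptography.QReg 1 → ℂ) (k l : ℕ), ψ (fun _ => false) ≠ 0 → Literature.Computability.QuantumComplexity.stabilizerRank (Literature.Computability.QuantumComplexity.tensorPow ψ k) ≤ Literature.Computability.QuantumComplexity.stabilizerRank (Literature.Computability.QuantumComplexity.tensorPow ψ (k + l))

/-- item stmt-QuantumAdvantage-8341 · support · rank 9 · closed · moot by None · by planner
sources: PelegShpilkaVolk2022, LovitzSteffan2022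
[support] MILESTONE statement (new S-side decl between 1794 and 2115): stretched-exponential exact
magic rank, ∃ c > 0 ∃ n₀ ∀ n ≥ n₀, 2^{c√n} < χ(T^{⊗n}). Not to be attacked directly; reached from
GenericSpanExponential by ExponentialGlue (i) (a 2^{Ω(τ)}-angle supply at T-count τ,
Kliuchnikov–Maslov–Mosca / Ross–Selinger counting, would sharpen it to 2^{Ω(n / log n)} — see Not
decomposed yet). [difficulty: open-problem] -/
@[route_item "route-QuantumAdvantage-GenericAngle"]
def StretchedExpRank : Prop :=
  ∃ c : ℝ, 0 < c ∧ ∃ n₀ : ℕ, ∀ n ≥ n₀, (2 : ℝ) ^ (c * Real.sqrt n) < (Literature.Computability.QuantumComplexity.stabilizerRank (Literature.Computability.QuantumComplexity.tensorPow Literature.Computability.QuantumComplexity.magicT n) : ℝ)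

/-- item stmt-QuantumAdvantage-8342 · support · rank 9 · closed · moot by None · by planner
sources: LovitzSteffan2022, BravyiSmithSmolin2016
[support] glue for both exponential upgrades (provable now). (i) GenericSpanExponential →
GenericLeMagic → CopyMonotone → StretchedExpRank: for n large put m = ⌊√(n/2)⌋ (so 2m² ≤ n and m ≥
the crux's n₀); χ(T^{⊗n}) ≥ χ(T^{⊗2m²}) ≥ r/(m+1) > 2^{cm}/(m+1) ≥ 2^{(c/4)√n} (Nat.sqrt/Real.sqrt
bookkeeping, magicT 0 = 1/√2 ≠ 0). (ii) GenericSpanExponential → MagicDefectSubexp →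
ExpStabilizerRank (the card's original assembly K3 ∧ K2 ⇒ exponential): take ε = c/2, then 2^{cn} <
r ≤ 2^{εn}·χ(T^{⊗n}) gives χ(T^{⊗n}) > 2^{(c/2)n}. [difficulty: provable-now] -/
@[route_item "route-QuantumAdvantage-GenericAngle"]
def ExponentialGlue : Prop :=
  (GenericSpanExponential → GenericLeMagic → CopyMonotone → StretchedExpRank) ∧ (GenericSpanExponential → MagicDefectSubexp → ExpStabilizerRank)

/-- item stmt-QuantumAdvantage-8343 · support · rank 9 · closed · moot by None · by planner
sources: LovitzSteffan2022, BravyiSmithSmolin2016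
[support] converse of the Assembly (provable now), recording X ⇔ stmt-1794: MagicLeGeneric →
ExactRankSuperpoly → GenericSpanSuperpoly. Given c and n₀ apply the target with exponent c'' =
max(c, 2^{n₀}): t^{c''} + c'' < χ(T^{⊗t}) ≤ 2^t (tree: stabilizerRank_le_two_pow) forces t > n₀, and
every stabilizer cover of Sym^t has r ≥ χ(T^{⊗t}) > t^{c''} + c'' ≥ t^c + c. [difficulty:
provable-now] -/
@[route_item "route-QuantumAdvantage-GenericAngle"]
def TargetImpliesGeneric : Prop :=
  MagicLeGeneric → ExactRankSuperpoly → GenericSpanSuperpoly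

/-- item stmt-QuantumAdvantage-8344 · support · rank 9 · closed · moot by None · by planner
sources: BravyiSmithSmolin2016, arXiv:1506.01396 p.6 Conjecture 1, card cusp-rank-tribonacci-census
[support] CALIBRATION (card P1, provable now): for every root u of u³ + u² + u = 1 (tribonacci: u =
1/T, T³ = T² + T + 1), χ((|0⟩ + u|1⟩)^{⊗3}) ≤ 3, by the identity (|0⟩+u|1⟩)^{⊗3} =
u·(|001⟩+|010⟩+|100⟩−|111⟩) + (1−u²)·(|000⟩+|111⟩) + u²·(|000⟩+|011⟩+|101⟩+|110⟩) (weights 0,1,2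
match identically, weight 3 reads −u + 1 − u² = u³); the three vectors are scaled stabilizer states:
CZ₁₂·X₃·(even-weight state), √2·GHZ = √2·CNOT₀₂CNOT₀₁H₀|000⟩, 2·H^{⊗3}GHZ. With χ(T^{⊗3}) = 3 (BSS16
table, 'believed tight'; lower bound = the card's exact census E_{3,2}, a finite certificate not
filed here) this is a non-stabilizer, non-magic angle of magic rank at n = 3: BravyiSmithSmolin2016
Conjecture 1 fails at n = 3. [difficulty: provable-now] -/
@[route_item "route-QuantumAdvantage-GenericAngle"]
def TribonacciRankThree : Prop :=
  ∀ u : ℂ, u ^ 3 + u ^ 2 + u = 1 → Literature.Computability.QuantumComplexity.stabilizerRank (Literature.Computability.QuantumComplexity.tensorPow (fun x : Literature.Computability.Cryptography.QReg 1 => if x 0 = true then u else 1) 3) ≤ 3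

/-- item stmt-QuantumAdvantage-8345 · assembly · rank 1 · closed · moot by None · by planner
sources: LovitzSteffan2022, BravyiGosset2016
[assembly] GenericSpanSuperpoly → GenericLeMagic → ExactRankSuperpoly (superpolynomial exact
stabilizer rank of |T⟩^{⊗t}, stmt-1794). -/
@[route_item "route-QuantumAdvantage-GenericAngle"]
def Assembly : Prop :=
  GenericSpanSuperpoly → GenericLeMagic → ExactRankSuperpoly

end Summit.QuantumAdvantage.QuantumAdvantage.Theses.GenericAngle
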